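import Mathlib
import HarnessLib
import Literature.Topology.Euclidean.PlanarStaircase
import Summits.NavierStokesRegularity.NavierStokesRegularity.Theorems.UnthreadedDoorNetFluxSphereMinusFinite

/-!
# Route `UnthreadedDoor`, crux `PoloidalLiouville` (stmt-NavierStokesRegularity-1222), WALL W1 — crux idea «cell-flux»:
# A RELATIVELY OPEN CONNECTED SUBSET OF A ROUND SPHERE MINUS FINITELY MANY POINTS IS CONNECTED (local charts, one-point removal)

Support file (seat leafhand-ns-unthreadeddoor-3 g7, cell decomp-ns), `--supports stmt-NavierStokesRegularity-1222 --as helper`; theorems only.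

The topological input of «head coherence of a CELL» in the cell-flux chain (`…UnthreadedDoorCellFluxDefs`, classes of admissible rules are
unions of cells = components of `S_r ∖ Γ`): to feed a cell to `CellFlux.headCoherent_of_analytic_regular_on` (p828998) one removes its finitely
many isolated critical points and needs the remainder to be PRECONNECTED and DENSE in the cell.  `…NetFluxSphereMinusFinite` (H2, p678489) did
this for the whole sphere (four coordinate hemispheres); here the local version:

* `exists_chart_nbhd_axis2` / `exists_chart_nbhd` — every point `x` of `S_r(x₀) ∩ O` (`O` open, `r > 0`) has a relatively open neighbourhood
  `S_r ∩ O' ⊆ O` which stays PRECONNECTED after removing ANY finite set (graph chart over a disc of `ℂ`: the connected component of the chart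
  preimage of `O`, and `Literature.Topology.Euclidean.isPreconnected_diff_finite`; other axes by coordinate-swap isometries);
* ★ `isPreconnected_sphere_inter_diff_singleton` / ★★ `isPreconnected_sphere_inter_diff_finite` — a PRECONNECTED relatively open set
  `S_r(x₀) ∩ O` minus one point / minus a finite set is preconnected (separation argument at the removed point);
* `sphere_inter_subset_closure_diff_finite` — and the finite set is nowhere dense in it.

Nothing about Navier–Stokes; `PoloidalLiouville` (1222), W1 and NS regularity stay OPEN. [folklore]
-/

noncomputable section

set_option linter.dupNamespace false

open Set Function Filter Topology Metric Complex
open scoped RealInnerProductSpace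

namespace Summit.NavierStokesRegularity.NavierStokesRegularity.Theorems.PoloidalLiouville.CellFlux

open Summit.NavierStokesRegularity.NavierStokesRegularity.Theorems.PoloidalLiouville.NetFlux (E3)

/-! ### 1. Local charts: punctured-preconnected relatively open neighbourhoods -/

/-- **Chart neighbourhoods on a coordinate hemisphere.**  Let `x ∈ S_r(x₀) ∩ O` (`O` open, `r > 0`) lie in the open hemisphere
`{s·(y − x₀)₂ > 0}` (`s = ±1`).  Then there is an open `O' ∋ x` with `S_r ∩ O' ⊆ O` such that `(S_r ∩ O') ∖ F` is preconnected for EVERY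
finite `F`: `S_r ∩ O'` is the image, under the graph map `w ↦ x₀ + (Re w, Im w, s√(r² − |w|²))`, of the connected component of the chart
preimage of `O` in the disc `|w| < r`, and an open connected planar set minus finitely many points is connected
(`Literature.Topology.Euclidean.isPreconnected_diff_finite`). [folklore] -/
theorem exists_chart_nbhd_axis2 (x₀ : E3) {r : ℝ} (hr : 0 < r) {s : ℝ} (hs : s = 1 ∨ s = -1)
    {O : Set E3} (hO : IsOpen O) {x : E3} (hx : x ∈ Metric.sphere x₀ r) (hsx : 0 < s * (x - x₀) 2) (hxO : x ∈ O) :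
    ∃ O' : Set E3, IsOpen O' ∧ x ∈ O' ∧ Metric.sphere x₀ r ∩ O' ⊆ O ∧
      ∀ F : Set E3, F.Finite → IsPreconnected ((Metric.sphere x₀ r ∩ O') \ F) := by
  have norm_sq_eq_coord : ∀ y : E3, ‖y‖ ^ 2 = y 0 ^ 2 + y 1 ^ 2 + y 2 ^ 2 := fun y => by
    rw [EuclideanSpace.norm_eq, Real.sq_sqrt (Finset.sum_nonneg fun i _ => by positivity), Fin.sum_univ_three]
    simp only [Real.norm_eq_abs, sq_abs]
  have hs2 : s ^ 2 = 1 := by rcases hs with rfl | rfl <;> norm_num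
  -- the graph chart over the disc `|w| < r`
  set lift : ℂ → E3 := fun w => x₀ +
    ((w.re) • EuclideanSpace.single (0 : Fin 3) (1 : ℝ) + (w.im) • EuclideanSpace.single (1 : Fin 3) (1 : ℝ)
      + (s * Real.sqrt (r ^ 2 - ‖w‖ ^ 2)) • EuclideanSpace.single (2 : Fin 3) (1 : ℝ)) with hlift
  have hlift_cont : Continuous lift := by
    refine continuous_const.add ((?_ : Continuous _).add ?_)
    · exact (continuous_re.smul continuous_const).add (continuous_im.smul continuous_const)
    · exact (continuous_const.mul ((continuous_const.sub (continuous_norm.pow 2)).sqrt)).smul continuous_const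
  have hl0 : ∀ w : ℂ, (lift w - x₀) 0 = w.re := by intro w; simp [hlift]
  have hl1 : ∀ w : ℂ, (lift w - x₀) 1 = w.im := by intro w; simp [hlift]
  have hl2 : ∀ w : ℂ, (lift w - x₀) 2 = s * Real.sqrt (r ^ 2 - ‖w‖ ^ 2) := by intro w; simp [hlift]
  have hw2 : ∀ w : ℂ, w.re ^ 2 + w.im ^ 2 = ‖w‖ ^ 2 := fun w => by rw [Complex.sq_norm, Complex.normSq_apply]; ring
  -- the planar projection (first two coordinates) inverts the chart
  set proj : E3 → ℂ := fun y => ((y - x₀) 0 : ℂ) + ((y - x₀) 1 : ℂ) * I with hproj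
  have hproj_cont : Continuous proj := by
    rw [hproj]
    fun_prop
  have hre : ∀ y : E3, (proj y).re = (y - x₀) 0 := fun y => by simp [hproj]
  have him : ∀ y : E3, (proj y).im = (y - x₀) 1 := fun y => by simp [hproj]
  have hproj_lift : ∀ w : ℂ, proj (lift w) = w := fun w =>
    Complex.ext (by rw [hre, hl0]) (by rw [him, hl1])
  have hinj : Injective lift := fun a b hab => by rw [← hproj_lift a, ← hproj_lift b, hab]
  -- `lift` maps the open disc into the open hemisphere, onto it
  have hlift_mem : ∀ w : ℂ, ‖w‖ < r → lift w ∈ Metric.sphere x₀ r ∧ 0 < s * (lift w - x₀) 2 := by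
    intro w hw
    have hpos : 0 < r ^ 2 - ‖w‖ ^ 2 := by nlinarith [norm_nonneg w]
    have hsq : ‖lift w - x₀‖ ^ 2 = r ^ 2 := by
      rw [norm_sq_eq_coord, hl0, hl1, hl2, mul_pow, hs2, one_mul, Real.sq_sqrt hpos.le, hw2]; ring
    refine ⟨?_, ?_⟩
    · rw [mem_sphere_iff_norm]; nlinarith [norm_nonneg (lift w - x₀)]
    · rw [hl2, ← mul_assoc, ← sq, hs2, one_mul]; exact Real.sqrt_pos.2 hpos
  have honto : ∀ y : E3, y ∈ Metric.sphere x₀ r → 0 < s * (y - x₀) 2 → ‖proj y‖ < r ∧ lift (proj y) = y := by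
    intro y hy hsy
    have hy2 : (y - x₀) 2 ≠ 0 := fun h0 => by rw [h0, mul_zero] at hsy; exact lt_irrefl _ hsy
    have hwsq : ‖proj y‖ ^ 2 = r ^ 2 - ((y - x₀) 2) ^ 2 := by
      rw [← hw2, hre y, him y, ← mem_sphere_iff_norm.1 hy, norm_sq_eq_coord]; ring
    have hwlt : ‖proj y‖ < r := by
      have : 0 < ((y - x₀) 2) ^ 2 := by positivity
      nlinarith [norm_nonneg (proj y)]
    refine ⟨hwlt, ?_⟩
    have h3 : s * Real.sqrt (r ^ 2 - ‖proj y‖ ^ 2) = (y - x₀) 2 := by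
      rw [hwsq, sub_sub_cancel, Real.sqrt_sq_eq_abs]
      rcases hs with rfl | rfl
      · rw [one_mul] at hsy ⊢; exact abs_of_pos hsy
      · have : (y - x₀) 2 < 0 := by linarith
        rw [abs_of_neg this]; ring
    rw [← sub_left_inj (a := x₀)]
    ext i
    fin_cases i
    · exact (hl0 _).trans (hre y)
    · exact (hl1 _).trans (him y)
    · exact (hl2 _).trans h3
  -- the chart preimage of `O` and its component through `proj x`
  set W : Set ℂ := Metric.ball (0 : ℂ) r ∩ lift ⁻¹' O with hW
  have hWo : IsOpen W := Metric.isOpen_ball.inter (hO.preimage hlift_cont)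
  obtain ⟨hxw, hliftx⟩ := honto x hx hsx
  have hxW : proj x ∈ W := ⟨by simpa using hxw, by show lift (proj x) ∈ O; rwa [hliftx]⟩
  set W₀ : Set ℂ := connectedComponentIn W (proj x) with hW₀
  have hW₀o : IsOpen W₀ := hWo.connectedComponentIn
  have hW₀c : IsPreconnected W₀ := isPreconnected_connectedComponentIn
  have hW₀W : W₀ ⊆ W := connectedComponentIn_subset _ _
  have hxW₀ : proj x ∈ W₀ := mem_connectedComponentIn hxW
  -- the neighbourhood: hemisphere ∩ proj⁻¹(W₀)
  set H : Set E3 := {y : E3 | 0 < s * (y - x₀) 2} with hH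
  have hHo : IsOpen H := by
    have hc : Continuous fun y : E3 => s * (y - x₀) 2 := by fun_prop
    exact isOpen_lt continuous_const hc
  refine ⟨H ∩ proj ⁻¹' W₀, hHo.inter (hW₀o.preimage hproj_cont), ⟨hsx, hxW₀⟩, ?_, fun F hF => ?_⟩
  · rintro y ⟨hy, hyH, hyW₀⟩
    obtain ⟨-, hlifty⟩ := honto y hy hyH
    have h := (hW₀W hyW₀).2
    rwa [mem_preimage, hlifty] at h
  · have himage : lift '' (W₀ \ lift ⁻¹' F) = (Metric.sphere x₀ r ∩ (H ∩ proj ⁻¹' W₀)) \ F := by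
      ext y
      constructor
      · rintro ⟨w, ⟨hw, hwF⟩, rfl⟩
        have hwr : ‖w‖ < r := by simpa using (hW₀W hw).1
        refine ⟨⟨(hlift_mem w hwr).1, (hlift_mem w hwr).2, ?_⟩, hwF⟩
        show proj (lift w) ∈ W₀
        rwa [hproj_lift]
      · rintro ⟨⟨hyS, hyH, hyW₀⟩, hyF⟩
        obtain ⟨-, hlifty⟩ := honto y hyS hyH
        exact ⟨proj y, ⟨hyW₀, by rwa [mem_preimage, hlifty]⟩, hlifty⟩
    rw [← himage]
    exact (Literature.Topology.Euclidean.isPreconnected_diff_finite hW₀o hW₀c (hF.preimage hinj.injOn)).image lift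
      hlift_cont.continuousOn

/-- **Transport of chart neighbourhoods by a linear isometry of `ℝ³`** (used with coordinate swaps to reach the other hemispheres): if
`Φ x` lies in the open axis-`2` hemisphere of the sphere about `Φ x₀`, the chart neighbourhood there pulls back along `Φ`. [folklore] -/
theorem exists_chart_nbhd_of_isometry (Φ : E3 ≃ₗᵢ[ℝ] E3) (x₀ : E3) {r : ℝ} (hr : 0 < r) {s : ℝ} (hs : s = 1 ∨ s = -1)
    {O : Set E3} (hO : IsOpen O) {x : E3} (hx : x ∈ Metric.sphere x₀ r) (hsx : 0 < s * (Φ x - Φ x₀) 2)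
    (hxO : x ∈ O) :
    ∃ O' : Set E3, IsOpen O' ∧ x ∈ O' ∧ Metric.sphere x₀ r ∩ O' ⊆ O ∧
      ∀ F : Set E3, F.Finite → IsPreconnected ((Metric.sphere x₀ r ∩ O') \ F) := by
  have hsph : ∀ y : E3, Φ y ∈ Metric.sphere (Φ x₀) r ↔ y ∈ Metric.sphere x₀ r := fun y => by
    rw [mem_sphere_iff_norm, mem_sphere_iff_norm, ← map_sub, LinearIsometryEquiv.norm_map]
  have hΦO : IsOpen (Φ '' O) := Φ.toHomeomorph.isOpenMap O hO
  obtain ⟨O', hO'o, hxO', hsub, hconn⟩ :=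
    exists_chart_nbhd_axis2 (Φ x₀) hr hs hΦO ((hsph x).2 hx) hsx (mem_image_of_mem Φ hxO)
  refine ⟨Φ ⁻¹' O', hO'o.preimage Φ.continuous, hxO', ?_, fun F hF => ?_⟩
  · rintro y ⟨hy, hyO'⟩
    obtain ⟨z, hz, hzy⟩ := hsub ⟨(hsph y).2 hy, hyO'⟩
    rw [← Φ.injective hzy]
    exact hz
  · have himg : Φ.symm '' ((Metric.sphere (Φ x₀) r ∩ O') \ Φ '' F) = (Metric.sphere x₀ r ∩ Φ ⁻¹' O') \ F := by
      ext y
      constructor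
      · rintro ⟨z, ⟨⟨hzS, hzO'⟩, hzF⟩, rfl⟩
        refine ⟨⟨(hsph _).1 (by simpa using hzS), by simpa using hzO'⟩, fun hyF => hzF ?_⟩
        exact ⟨Φ.symm z, hyF, by simp⟩
      · rintro ⟨⟨hyS, hyO'⟩, hyF⟩
        refine ⟨Φ y, ⟨⟨(hsph y).2 hyS, hyO'⟩, ?_⟩, by simp⟩
        rintro ⟨z, hzF, hzy⟩
        rw [Φ.injective hzy] at hzF
        exact hyF hzF
    rw [← himg]
    exact (hconn (Φ '' F) (hF.image Φ)).image _ Φ.symm.continuous.continuousOn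

/-- **Chart neighbourhoods at every point of the sphere.**  Every `x ∈ S_r(x₀) ∩ O` (`O` open, `r > 0`) has an open `O' ∋ x` with
`S_r ∩ O' ⊆ O` and `(S_r ∩ O') ∖ F` preconnected for every finite `F` (some coordinate of `x − x₀` is non-zero; swap it to the axis `2`).
[folklore] -/
theorem exists_chart_nbhd (x₀ : E3) {r : ℝ} (hr : 0 < r) {O : Set E3} (hO : IsOpen O) {x : E3}
    (hx : x ∈ Metric.sphere x₀ r) (hxO : x ∈ O) :
    ∃ O' : Set E3, IsOpen O' ∧ x ∈ O' ∧ Metric.sphere x₀ r ∩ O' ⊆ O ∧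
      ∀ F : Set E3, F.Finite → IsPreconnected ((Metric.sphere x₀ r ∩ O') \ F) := by
  have hne : x - x₀ ≠ 0 := by
    rw [← norm_ne_zero_iff, mem_sphere_iff_norm.1 hx]
    exact hr.ne'
  have hcoord : ∃ i : Fin 3, (x - x₀) i ≠ 0 := by
    by_contra h
    push Not at h
    exact hne (by ext i; simpa using h i)
  obtain ⟨i, hi⟩ := hcoord
  set Φ : E3 ≃ₗᵢ[ℝ] E3 := LinearIsometryEquiv.piLpCongrLeft 2 ℝ ℝ (Equiv.swap i 2) with hΦ
  have hΦ2 : ∀ y : E3, (Φ y) 2 = y i := fun y => by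
    simp [hΦ, LinearIsometryEquiv.piLpCongrLeft_apply, Equiv.swap_apply_right]
  rcases lt_or_gt_of_ne hi with hneg | hpos
  · exact exists_chart_nbhd_of_isometry Φ x₀ hr (s := -1) (Or.inr rfl) hO hx (by rw [← map_sub, hΦ2]; linarith) hxO
  · exact exists_chart_nbhd_of_isometry Φ x₀ hr (s := 1) (Or.inl rfl) hO hx (by rw [← map_sub, hΦ2]; linarith) hxO

/-! ### 2. ★ One-point and finite removal from a preconnected relatively open subset of the sphere -/

/-- ★ **One point.**  If `S_r(x₀) ∩ O` (`O` open, `r > 0`) is preconnected, so is `(S_r(x₀) ∩ O) ∖ {p}`.  [Separation argument: a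
chart neighbourhood `S_r ∩ O' ∋ p` stays preconnected when punctured, so it lies on one side; then `u ∪ O'` and `v` would separate
`S_r ∩ O` itself, the point `p` being reached through `O'`.] [folklore] -/
theorem isPreconnected_sphere_inter_diff_singleton (x₀ : E3) {r : ℝ} (hr : 0 < r) {O : Set E3} (hO : IsOpen O)
    (hK : IsPreconnected (Metric.sphere x₀ r ∩ O)) (p : E3) :
    IsPreconnected ((Metric.sphere x₀ r ∩ O) \ {p}) := by
  set S : Set E3 := Metric.sphere x₀ r with hS
  by_cases hp : p ∈ S ∩ O
  swap
  · rwa [sdiff_singleton_eq_self hp]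
  obtain ⟨O', hO'o, hpO', hsub, hconn⟩ := exists_chart_nbhd x₀ hr hO hp.1 hp.2
  have hVp : IsPreconnected ((S ∩ O') \ {p}) := hconn {p} (finite_singleton p)
  have hVsub : (S ∩ O') \ {p} ⊆ (S ∩ O) \ {p} := sdiff_subset_sdiff_left fun y hy => ⟨hy.1, hsub hy⟩
  -- the key step, for one orientation of the separation
  have key : ∀ {u v : Set E3}, IsOpen u → IsOpen v → (S ∩ O) \ {p} ⊆ u ∪ v → ((S ∩ O) \ {p}) ∩ (u ∩ v) = ∅ →
      (((S ∩ O) \ {p}) ∩ v).Nonempty → ¬ ((S ∩ O') \ {p} ⊆ u) := by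
    intro u v hu hv hcover hemp hbv hVu
    obtain ⟨b, hbK, hbv⟩ := hbv
    have hcov' : S ∩ O ⊆ (u ∪ O') ∪ v := by
      intro y hy
      by_cases hyp : y = p
      · exact Or.inl (Or.inr (hyp ▸ hpO'))
      · rcases hcover ⟨hy, hyp⟩ with h | h
        · exact Or.inl (Or.inl h)
        · exact Or.inr h
    obtain ⟨q, hqK, hqu', hqv⟩ := hK (u ∪ O') v (hu.union hO'o) hv hcov' ⟨p, hp, Or.inr hpO'⟩ ⟨b, hbK.1, hbv⟩
    by_cases hqp : q = p
    · subst hqp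
      obtain ⟨q', ⟨⟨hq'S, hq'O', hq'v⟩, hq'p⟩⟩ :=
        NetFlux.nonempty_sphere_inter_diff_finite hr hqK.1 (hO'o.inter hv) ⟨hpO', hqv⟩ (finite_singleton q)
      have hq'u : q' ∈ u := hVu ⟨⟨hq'S, hq'O'⟩, hq'p⟩
      have hmem : q' ∈ ((S ∩ O) \ {q}) ∩ (u ∩ v) := ⟨⟨⟨hq'S, hsub ⟨hq'S, hq'O'⟩⟩, hq'p⟩, hq'u, hq'v⟩
      rw [hemp] at hmem
      exact hmem
    · rcases hqu' with hqu | hqO'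
      · have hmem : q ∈ ((S ∩ O) \ {p}) ∩ (u ∩ v) := ⟨⟨hqK, hqp⟩, hqu, hqv⟩
        rw [hemp] at hmem
        exact hmem
      · have hqu : q ∈ u := hVu ⟨⟨hqK.1, hqO'⟩, hqp⟩
        have hmem : q ∈ ((S ∩ O) \ {p}) ∩ (u ∩ v) := ⟨⟨hqK, hqp⟩, hqu, hqv⟩
        rw [hemp] at hmem
        exact hmem
  -- the separation argument
  rw [isPreconnected_iff_subset_of_disjoint] at hVp ⊢
  intro u v hu hv hcover hemp
  have hVuv0 : ((S ∩ O') \ {p}) ∩ (u ∩ v) = ∅ :=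
    eq_empty_of_subset_empty (hemp ▸ inter_subset_inter_left (u ∩ v) hVsub)
  rcases hVp u v hu hv (hVsub.trans hcover) hVuv0 with hVu | hVv
  · -- then `(S ∩ O) \ {p} ⊆ u`, for otherwise it meets `v`
    left
    intro y hy
    rcases hcover hy with hyu | hyv
    · exact hyu
    · exact absurd hVu (key hu hv hcover hemp ⟨y, hy, hyv⟩)
  · right
    intro y hy
    rcases hcover hy with hyu | hyv
    · refine absurd hVv (key hv hu (by rwa [union_comm]) (by rwa [inter_comm v u]) ⟨y, hy, hyu⟩)
    · exact hyv

/-- ★★ **Finitely many points.**  If `S_r(x₀) ∩ O` (`O` open, `r > 0`) is preconnected, so is `(S_r(x₀) ∩ O) ∖ F` for every finite `F`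
(induction, `O ∖ s` staying open). [folklore] -/
theorem isPreconnected_sphere_inter_diff_finite (x₀ : E3) {r : ℝ} (hr : 0 < r) {O : Set E3} (hO : IsOpen O)
    (hK : IsPreconnected (Metric.sphere x₀ r ∩ O)) {F : Set E3} (hF : F.Finite) :
    IsPreconnected ((Metric.sphere x₀ r ∩ O) \ F) := by
  induction F, hF using Set.Finite.induction_on with
  | empty => rwa [sdiff_empty]
  | @insert a s _ hs ih =>
    have h1 : (Metric.sphere x₀ r ∩ O) \ insert a s = (Metric.sphere x₀ r ∩ (O \ s)) \ {a} := by
      ext y; simp only [Set.mem_sdiff, mem_inter_iff, mem_insert_iff, mem_singleton_iff]; tauto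
    have h2 : (Metric.sphere x₀ r ∩ O) \ s = Metric.sphere x₀ r ∩ (O \ s) := by
      ext y; simp only [Set.mem_sdiff, mem_inter_iff]; tauto
    rw [h1]
    rw [h2] at ih
    exact isPreconnected_sphere_inter_diff_singleton x₀ hr (hO.sdiff hs.isClosed) ih a

/-- **A finite set is nowhere dense in a relatively open subset of the sphere**: `S_r(x₀) ∩ O ⊆ closure ((S_r(x₀) ∩ O) ∖ F)`. [folklore] -/
theorem sphere_inter_subset_closure_diff_finite (x₀ : E3) {r : ℝ} (hr : 0 < r) {O : Set E3} (hO : IsOpen O)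
    {F : Set E3} (hF : F.Finite) : Metric.sphere x₀ r ∩ O ⊆ closure ((Metric.sphere x₀ r ∩ O) \ F) := by
  rintro x ⟨hx, hxO⟩
  rw [mem_closure_iff_nhds]
  intro U hU
  obtain ⟨U', hU'U, hU'o, hxU'⟩ := _root_.mem_nhds_iff.1 hU
  obtain ⟨y, ⟨hyS, hyO, hyU'⟩, hyF⟩ :=
    NetFlux.nonempty_sphere_inter_diff_finite hr hx (hO.inter hU'o) ⟨hxO, hxU'⟩ hF
  exact ⟨y, hU'U hyU', ⟨hyS, hyO⟩, hyF⟩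

end Summit.NavierStokesRegularity.NavierStokesRegularity.Theorems.PoloidalLiouville.CellFlux

end
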